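import Mathlib.RepresentationTheory.Invariants
import Mathlib.Topology.Separation.Hausdorff
import Mathlib.Algebra.Module.LinearMap.End

/-!
# The fixed vectors of a family of continuous operators form a closed, commutant-stable
# subspace (Tier 5, N4.3 (A4)(2))

Kernel form of the sentence of route/T5-N4-p5.md (A4)(2) (l. 149):

«`π₀^{K′_f}` is a closed `G_∞`-invariant subspace of `π₀` (`G_∞` commutes with `K′_f`)».

Abstract setting: a representation `ρ` of a group `G` on a `k`-module `V` carrying a Hausdorff
topology, every `ρ g` continuous. Then

* the subspace of invariants `ρ.invariants = {v | ∀ g, ρ g v = v}` (Mathlib's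
  `Representation.invariants`) is CLOSED: it is the intersection over `g` of the closed sets
  `{v | ρ g v = v}` (`isClosed_eq` in a `T2Space`) — `isClosed_invariants`; for a subgroup `H`
  the `H`-invariants are the invariants of the restricted representation `ρ.comp H.subtype`
  (`isClosed_invariants_subgroup`);
* every operator `X` commuting with all `ρ g` maps the invariants into themselves
  (`apply_mem_invariants_of_comm`, `map_invariants_le_of_comm`), and for a second representation
  `σ` of a group `G'` whose operators commute with those of `H ≤ G`, the `H`-invariants are a
  closed `σ`-stable subspace (`isClosed_and_forall_apply_mem_invariants_subgroup`), which is the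
  sentence above with `ρ` = the `G(𝔸_f)`-action, `H = K′_f`, `σ` = the `G_∞`-action on `π₀`.

Everything is Mathlib-only; the only topological input is the Hausdorff property of `V` and the
continuity of the operators `ρ g` (no completeness, no norm).
-/

namespace Summit.Ventures.HodgeRepro2.T5InvariantsClosed

open Set

variable {k V G : Type*} [CommRing k] [AddCommGroup V] [Module k V] [Group G]

section Algebra

/-- An operator commuting with every `ρ g` maps the invariants of `ρ` into themselves:
`ρ g (X v) = X (ρ g v) = X v`. -/
theorem apply_mem_invariants_of_comm (ρ : Representation k G V) (X : Module.End k V)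
    (hC : ∀ g : G, ρ g * X = X * ρ g) {v : V} (hv : v ∈ ρ.invariants) : X v ∈ ρ.invariants := by
  rw [Representation.mem_invariants] at hv ⊢
  intro g
  rw [← Module.End.mul_apply, hC g, Module.End.mul_apply, hv g]

/-- The image of the invariants under an operator commuting with `ρ` lies in the invariants. -/
theorem map_invariants_le_of_comm (ρ : Representation k G V) (X : Module.End k V)
    (hC : ∀ g : G, ρ g * X = X * ρ g) : ρ.invariants.map X ≤ ρ.invariants := by
  rintro _ ⟨v, hv, rfl⟩
  exact apply_mem_invariants_of_comm ρ X hC hv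

/-- Membership in the invariants of the restriction of `ρ` to a subgroup `H`:
`v ∈ Representation.invariants (ρ.comp H.subtype) ↔ ∀ h ∈ H, ρ h v = v`. -/
theorem mem_invariants_subgroup_iff (ρ : Representation k G V) (H : Subgroup G) (v : V) :
    v ∈ Representation.invariants (ρ.comp H.subtype) ↔ ∀ h ∈ H, ρ h v = v := by
  rw [Representation.mem_invariants]
  constructor
  · intro hv h hh
    exact hv ⟨h, hh⟩
  · intro hv h
    exact hv h h.2

/-- An operator commuting with `ρ h` for every `h ∈ H` maps the `H`-invariants into
themselves. -/
theorem apply_mem_invariants_subgroup_of_comm (ρ : Representation k G V) (H : Subgroup G)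
    (X : Module.End k V) (hC : ∀ h ∈ H, ρ h * X = X * ρ h) {v : V}
    (hv : v ∈ Representation.invariants (ρ.comp H.subtype)) :
    X v ∈ Representation.invariants (ρ.comp H.subtype) :=
  apply_mem_invariants_of_comm (ρ.comp H.subtype) X (fun h => hC h h.2) hv

/-- The `σ`-image of the `H`-invariants lies in the `H`-invariants (submodule form), when the
operators of `σ` commute with those of `H`. -/
theorem map_invariants_subgroup_le {G' : Type*} [Group G'] (ρ : Representation k G V)
    (H : Subgroup G) (σ : Representation k G' V)
    (hcomm : ∀ (g' : G') (h : G), h ∈ H → ρ h * σ g' = σ g' * ρ h) (g' : G') :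
    (Representation.invariants (ρ.comp H.subtype)).map (σ g') ≤
      Representation.invariants (ρ.comp H.subtype) :=
  map_invariants_le_of_comm (ρ.comp H.subtype) (σ g') fun h => hcomm g' h h.2

/-- The invariants are the intersection of the fixed sets of the operators `ρ g`. -/
theorem coe_invariants_eq_iInter (ρ : Representation k G V) :
    (ρ.invariants : Set V) = ⋂ g : G, {v : V | ρ g v = v} := by
  ext v
  simp only [SetLike.mem_coe, Representation.mem_invariants, mem_iInter, mem_setOf_eq]

end Algebra

section Topology

variable [TopologicalSpace V] [T2Space V]

/-- The fixed set of a continuous linear operator on a Hausdorff space is closed. -/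
theorem isClosed_setOf_apply_eq (f : V →ₗ[k] V) (hf : Continuous f) :
    IsClosed {v : V | f v = v} :=
  isClosed_eq hf continuous_id

/-- **The invariants of a representation by continuous operators form a closed subspace.** -/
theorem isClosed_invariants (ρ : Representation k G V) (hρ : ∀ g : G, Continuous (ρ g)) :
    IsClosed (ρ.invariants : Set V) := by
  rw [coe_invariants_eq_iInter]
  exact isClosed_iInter fun g => isClosed_setOf_apply_eq (ρ g) (hρ g)

/-- **The `H`-invariants are closed** for every subgroup `H ≤ G`, when the operators `ρ g` are
continuous. -/
theorem isClosed_invariants_subgroup (ρ : Representation k G V) (H : Subgroup G)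
    (hρ : ∀ g : G, Continuous (ρ g)) :
    IsClosed (Representation.invariants (ρ.comp H.subtype) : Set V) :=
  isClosed_invariants (ρ.comp H.subtype) fun h => hρ h

/-- **(A4)(2): `π₀^{K′_f}` is a closed `G_∞`-invariant subspace.** For a representation `ρ` of `G`
by continuous operators, a subgroup `H ≤ G`, and a second representation `σ` of a group `G'` whose
operators commute with `ρ h` for `h ∈ H`: the `H`-invariants `V^H` form a closed subspace stable
under every `σ g'`. -/
theorem isClosed_and_forall_apply_mem_invariants_subgroup {G' : Type*} [Group G']
    (ρ : Representation k G V) (H : Subgroup G) (hρ : ∀ g : G, Continuous (ρ g))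
    (σ : Representation k G' V) (hcomm : ∀ (g' : G') (h : G), h ∈ H → ρ h * σ g' = σ g' * ρ h) :
    IsClosed (Representation.invariants (ρ.comp H.subtype) : Set V) ∧
      ∀ (g' : G') (v : V), v ∈ Representation.invariants (ρ.comp H.subtype) →
        σ g' v ∈ Representation.invariants (ρ.comp H.subtype) :=
  ⟨isClosed_invariants_subgroup ρ H hρ, fun g' _ hv =>
    apply_mem_invariants_subgroup_of_comm ρ H (σ g') (fun h hh => hcomm g' h hh) hv⟩

end Topology

end Summit.Ventures.HodgeRepro2.T5InvariantsClosed
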